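import Mathlib.NumberTheory.Padics.Hensel
import Literature.AlgebraicGeometry.Motives.FaltingsECEndCoreOpenSubgroupProofs
import Literature.NumberTheory.EllipticCurves.IsogenyHasCMBaseChangeProofs
import Literature.NumberTheory.EllipticCurves.SupersingularDensitySerreLadicCommutatorProofs
import Literature.NumberTheory.EllipticCurves.SupersingularDensityProofs
import Literature.NumberTheory.EllipticCurves.HasseWeilGoodReductionProofs
import Literature.NumberTheory.EllipticCurves.IsogenyFrobeniusTraceProofs
import Literature.NumberTheory.EllipticCurves.LFunctionPrimeCoeff
import HarnessLib

/-!
# Serre 1981, §8 Thm. 20 Cor. 2 (qualitative form): the supersingular primes of a non-CM `E/ℚ`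
have density `0` — the discharge `serre_supersingular_density_zero_holds`

Topic `NumberTheory/EllipticCurves`.  Theorem-only `Proofs` companion (nothing is defined, no named
fact is introduced) of `SupersingularDensity`, closing the named fact
`WeierstrassCurve.serre_supersingular_density_zero`:

> for `E/ℚ` in global minimal form without complex multiplication, the good supersingular primes
> (`p ∤ Δ`, `p ∣ a_p`) have natural density `0`

— J.-P. Serre, *Quelques applications du théorème de densité de Chebotarev*, Publ. Math. IHÉS 54
(1981), p. 123 (a) (`P_E(x) = o(x / log x)`) and §8, Thm. 20, Cor. 2 (245); Serre attributes the
qualitative statement to *Abelian ℓ-adic representations and elliptic curves* (1968), IV-13,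
Exercise 1.

## The proof

Part `SupersingularDensitySerreLadicCommutatorProofs` of this series
(`WeierstrassCurve.serre_supersingular_density_zero_of_galoisRepTate_mul_ne`, from the prime ideal
theorem, a Chebotarev-type natural upper bound, Cayley–Hamilton for Frobenius and a contraction
lemma for the tower `Gal(ℚ(E[ℓⁿ])/ℚ)`) reduced the fact to:

> (H) for every such `E` there is an odd prime `ℓ` such that for every `n` the image
> `ρ_{E,ℓ}(Gal(ℚ̄/ℚ(E[ℓⁿ])))` is not abelian

(Serre 1968, IV.2.2: `𝔤_ℓ = 𝔤𝔩₂`).  This file proves (H) (`exists_prime_forall_exists_mul_ne`)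
by an argument which, granted the tree, is elementary — it replaces the Lie-algebra / Hodge–Tate
input of Serre's proof by Frobenius elements with *split* characteristic polynomial:

1. *Irreducibility over every number field* (the deep input, a theorem of the tree): for an
   elliptic curve `E'` over a number field `L` with `End_L(E') = ℤ`, `V_ℓ E'` has no `Γ_L`-stable
   line — `Literature.AlgebraicGeometry.Motives.finrank_ne_one_of_stable_of_not_hasRationalCM_of_numberField`
   (Serre 1968, IV.2.1, from Shafarevich's theorem `finite_isogenyClass_holds` — Siegel — and Tate's
   line realization).  With the fixed field of an open subgroup `U ≤ Γ_K`, the restriction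
   `Γ_L → Γ_K` (`ArtinRestriction`), the transport `V_ℓ(E_L) ≅ V_ℓ(E)|_{Γ_L}`
   (`TateModuleGaloisTransportProofs`) and the invariance of geometric complex multiplication under
   base change (`IsogenyHasCMBaseChangeProofs`): **no open subgroup of `Γ_K` stabilizes a line of
   `V_ℓ E` when `End_{K̄}(E) = ℤ`** (`false_of_isOpen_of_stable_line`).
2. *Linear algebra.*  If `ρ(U)` is abelian and contains an element with two eigenvectors of
   distinct eigenvalues `μ₁ ≠ μ₂ ∈ ℚ_ℓ`, the `μ₁`-eigenline is `U`-stable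
   (`exists_mul_ne_mul_of_isOpen_of_eigenvector`).  So it suffices to put into every
   `ρ(Gal(ℚ̄/ℚ(E[ℓⁿ])))` an element with distinct `ℚ_ℓ`-rational eigenvalues.
3. *Split ordinary Frobenius.*  Take a good ordinary prime `p₀` (`p₀ ∤ a = a_{p₀}`; there are
   infinitely many, `infinite_goodOrdinaryPrimes_holds`), so `d = a² - 4p₀ ≠ 0`, and a prime
   `ℓ ∣ 4p₀²d - 1`: `ℓ` is odd, `ℓ ≠ p₀`, and `d ≡ (2p₀d)² (mod ℓ)` is a non-zero square mod `ℓ`,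
   hence `d = z²` in `ℤ_ℓ` (Hensel, Mathlib `hensels_lemma`; `exists_prime_sq_eq_padicInt`).  An
   arithmetic Frobenius `σ₀` at `p₀` has characteristic polynomial `X² - aX + p₀ = (X - α)(X - β)`
   on `V_ℓ E` (`trace_galoisRepTate_frobenius_eq_frobeniusTrace`,
   `det_galoisRepTate_frobenius_of_hasGoodReductionAt_holds`, `charpoly_tateModule_eq`), with
   `α - β = z ≠ 0`, hence eigenvectors `v₁, v₂`.
4. *Lucas sequences* (`pow_ne_pow_of_add_eq_of_mul_eq`): `αᶠ + βᶠ = L_f ∈ ℤ` with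
   `L_f ≡ aᶠ (mod p₀)`; if `αᶠ = βᶠ` then `L_f² = 4p₀ᶠ`, so `p₀ ∣ a` — excluded.  Hence for every
   `n`, with `U = ker ρ̄_{E,ℓⁿ}` and `f = [Γ_ℚ : U]`, the element `σ₀ᶠ ∈ U` acts with the distinct
   rational eigenvalues `αᶠ ≠ βᶠ` on `v₁, v₂`, and (2), (1) make `ρ(U)` non-abelian.

The theorem `serre_supersingular_density_zero_holds` then is
`serre_supersingular_density_zero_of_galoisRepTate_mul_ne` applied to (H).

## References

* [Serre1981] J.-P. Serre, Publ. Math. IHÉS 54 (1981), 123–201: p. 123 (a); §8 Thm. 20, Cor. 2.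
* [Serre1968] J.-P. Serre, *Abelian ℓ-adic representations and elliptic curves*, Benjamin 1968,
  IV.2.1–2.2 and IV-13 Exercise 1.
* [SilvermanAEC2009] J. H. Silverman, *The Arithmetic of Elliptic Curves*, 2nd ed., III.§7,
  V.§2, C.21 Remark 21.3, Cor. IX.6.2.
-/

noncomputable section

open scoped Classical NumberField
open IsDedekindDomain Field Polynomial Module

universe u

namespace WeierstrassCurve

open Literature.NumberTheory.EllipticCurves Literature.NumberTheory.GaloisRepresentations
  Literature.AlgebraicGeometry.Motives NumberField Rat.HeightOneSpectrum

/-! ## Algebra -/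

section Algebra

/-- **Lucas sequences: the Frobenius eigenvalues at an ordinary prime have no coinciding powers.**
Let `R` be a commutative ring of characteristic `0`, `α, β ∈ R` with `α + β = a ∈ ℤ` and
`αβ = p` a prime with `p ∤ a`.  Then `αᶠ ≠ βᶠ` for every `f ≥ 1`.  Indeed `αⁿ + βⁿ` is the image
of the integer Lucas sequence `L_n` (`L_{n+2} = a L_{n+1} - p L_n`), `L_n ≡ aⁿ (mod p)` for
`n ≥ 1`, and `αᶠ = βᶠ` would give `L_f² = 4 (αβ)ᶠ = 4pᶠ`, so `p ∣ L_f`, `p ∣ aᶠ`, `p ∣ a`.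
[folklore] -/
theorem pow_ne_pow_of_add_eq_of_mul_eq {R : Type*} [CommRing R] [CharZero R] {α β : R} {a : ℤ}
    {p : ℕ} (hp : p.Prime) (hpa : ¬ (p : ℤ) ∣ a) (hadd : α + β = a) (hmul : α * β = p) {f : ℕ}
    (hf : f ≠ 0) : α ^ f ≠ β ^ f := by
  -- the Lucas sequence, two consecutive terms at a time
  have key : ∀ n : ℕ,
      (∃ z : ℤ, (z : R) = α ^ (n + 1) + β ^ (n + 1) ∧ (p : ℤ) ∣ z - a ^ (n + 1)) ∧
      (∃ z : ℤ, (z : R) = α ^ (n + 2) + β ^ (n + 2) ∧ (p : ℤ) ∣ z - a ^ (n + 2)) := by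
    intro n
    induction n with
    | zero =>
      refine ⟨⟨a, by rw [zero_add, pow_one, pow_one, hadd], by simp⟩,
        ⟨a ^ 2 - 2 * p, ?_, ⟨-2, by ring⟩⟩⟩
      push_cast
      rw [← hadd, ← hmul]
      ring
    | succ n ih =>
      obtain ⟨⟨z₁, hz₁, hd₁⟩, ⟨z₂, hz₂, hd₂⟩⟩ := ih
      refine ⟨⟨z₂, hz₂, hd₂⟩, ⟨a * z₂ - p * z₁, ?_, ?_⟩⟩
      · push_cast
        rw [hz₁, hz₂, ← hadd, ← hmul]
        ring
      · have e : a * z₂ - p * z₁ - a ^ (n + 1 + 2) = a * (z₂ - a ^ (n + 2)) - p * z₁ := by ring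
        rw [e]
        exact dvd_sub (dvd_mul_of_dvd_right hd₂ a) (dvd_mul_right _ _)
  intro hαβ
  obtain ⟨m, rfl⟩ : ∃ m, f = m + 1 := ⟨f - 1, by omega⟩
  obtain ⟨⟨z, hz, hdz⟩, -⟩ := key m
  have hpp : _root_.Prime (p : ℤ) := Nat.prime_iff_prime_int.mp hp
  -- `z = 2 αᶠ`, so `z² = 4 pᶠ` in `ℤ`
  have hz2 : ((z ^ 2 : ℤ) : R) = ((4 * (p : ℤ) ^ (m + 1) : ℤ) : R) := by
    push_cast
    rw [hz, ← hmul, mul_pow, ← hαβ]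
    ring
  have hzz : z ^ 2 = 4 * (p : ℤ) ^ (m + 1) := Int.cast_injective hz2
  have hpz : (p : ℤ) ∣ z := by
    refine hpp.dvd_of_dvd_pow (n := 2) ⟨4 * (p : ℤ) ^ m, ?_⟩
    rw [hzz]
    ring
  have hpa' : (p : ℤ) ∣ a ^ (m + 1) := by
    have h := dvd_sub hpz hdz
    rwa [sub_sub_cancel] at h
  exact hpa (hpp.dvd_of_dvd_pow hpa')

variable {F V : Type*} [Field F] [AddCommGroup V] [Module F V]

/-- In a plane, the eigenspace of an endomorphism having two eigenvectors with distinct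
eigenvalues is a line. [folklore] -/
theorem finrank_eigenspace_eq_one_of_finrank_eq_two (h2 : finrank F V = 2) {g : Module.End F V}
    {μ₁ μ₂ : F} (hne : μ₁ ≠ μ₂) {v₁ v₂ : V} (hv₁ : v₁ ≠ 0) (hv₂ : v₂ ≠ 0) (h₁ : g v₁ = μ₁ • v₁)
    (h₂ : g v₂ = μ₂ • v₂) : finrank F (g.eigenspace μ₁) = 1 := by
  haveI : FiniteDimensional F V := Module.finite_of_finrank_eq_succ h2
  have hmem : v₁ ∈ g.eigenspace μ₁ := Module.End.mem_eigenspace_iff.mpr h₁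
  have hnmem : v₂ ∉ g.eigenspace μ₁ := by
    intro hv
    rw [Module.End.mem_eigenspace_iff, h₂] at hv
    have h0 : (μ₂ - μ₁) • v₂ = 0 := by rw [sub_smul, hv, sub_self]
    rcases smul_eq_zero.mp h0 with h | h
    · exact hne (sub_eq_zero.mp h).symm
    · exact hv₂ h
  have hne_bot : g.eigenspace μ₁ ≠ ⊥ := by
    intro h
    rw [h, Submodule.mem_bot] at hmem
    exact hv₁ hmem
  have hne_top : g.eigenspace μ₁ ≠ ⊤ := by
    intro h
    rw [h] at hnmem
    exact hnmem Submodule.mem_top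
  have hlt : finrank F (g.eigenspace μ₁) < 2 := h2 ▸ Submodule.finrank_lt hne_top
  have hpos : finrank F (g.eigenspace μ₁) ≠ 0 := by
    rw [Ne, Submodule.finrank_eq_zero]
    exact hne_bot
  omega

omit [Field F] [AddCommGroup V] [Module F V] in
/-- Powers of an endomorphism act on an eigenvector by powers of the eigenvalue. [folklore] -/
theorem pow_apply_of_apply_eq_smul {R M : Type*} [CommSemiring R] [AddCommMonoid M] [Module R M]
    {g : Module.End R M} {μ : R} {v : M} (h : g v = μ • v) (k : ℕ) : (g ^ k) v = μ ^ k • v := by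
  induction k with
  | zero => rw [pow_zero, pow_zero, one_smul, Module.End.one_apply]
  | succ k ih => rw [pow_succ, Module.End.mul_apply, h, map_smul, ih, smul_smul, ← pow_succ']

end Algebra

/-! ## No open subgroup of `Γ_K` stabilizes a line of `V_ℓ E` (`End_{K̄}(E) = ℤ`) -/

section OpenSubgroup

variable {K : Type u} [Field K] (W : WeierstrassCurve K) (ℓ : ℕ) [Fact ℓ.Prime]

/-- **No open subgroup of `Γ_K` stabilizes a line** (`End_{K̄}(E) = ℤ`).  For an elliptic curve
`E = W` over a number field `K` without complex multiplication over `K̄`, a prime `ℓ`, an open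
subgroup `U ≤ Γ_K` and a `ℚ_ℓ`-line `L₁ ⊆ V_ℓ E`: `L₁` is not `U`-stable.  Otherwise let `L = K̄^U`
(a number field) and `g ∈ Γ_K` with `res(Γ_L) = g U g⁻¹`
(`exists_mem_range_absGaloisRestrict_fixedField_iff`); the line `ρ(g) L₁` is stable under
`res(Γ_L)`, so its image under `V_ℓ(E) ≅ V_ℓ(E_L)`
(`WeierstrassCurve.exists_rationalTateModule_equiv_baseChange`) is a `Γ_L`-stable line of
`V_ℓ(E_L)`, while `E_L` has no `L`-rational complex multiplication
(`not_hasRationalCM_baseChange_of_not_hasCM`) — against the irreducibility of `V_ℓ(E_L)`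
(`finrank_ne_one_of_stable_of_not_hasRationalCM_of_numberField`, Serre 1968, IV.2.1).
[cite: Serre1968, Ch. IV §2.1] -/
theorem false_of_isOpen_of_stable_line [NumberField K] [W.IsElliptic] (hCM : ¬ W.HasCM)
    (U : Subgroup (absoluteGaloisGroup K)) (hU : IsOpen (U : Set (absoluteGaloisGroup K)))
    (L₁ : Submodule ℚ_[ℓ] (W.rationalTateModule ℓ)) (h₁ : finrank ℚ_[ℓ] L₁ = 1)
    (hst : ∀ σ ∈ U, ∀ v ∈ L₁, rationalGaloisRepTate W ℓ σ v ∈ L₁) : False := by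
  -- the fixed field `L = K̄^U`, a number field, and the restriction `Γ_L → Γ_K`
  set L : IntermediateField K (AlgebraicClosure K) := IntermediateField.fixedField U with hL
  haveI : FiniteDimensional K L := finiteDimensional_fixedField_of_isOpen U hU
  haveI : NumberField L := NumberField.of_module_finite K L
  obtain ⟨g, hg⟩ := exists_mem_range_absGaloisRestrict_fixedField_iff U hU
  -- the line `ρ(g) L₁`, stable under `g U g⁻¹ ⊇ res(Γ_L)`
  set ρ := rationalGaloisRepTate W ℓ with hρ
  let Eg : W.rationalTateModule ℓ ≃ₗ[ℚ_[ℓ]] W.rationalTateModule ℓ :=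
    LinearEquiv.ofLinear (ρ g) (ρ g⁻¹)
      (by rw [← Module.End.mul_eq_comp, ← map_mul, mul_inv_cancel, map_one, Module.End.one_eq_id])
      (by rw [← Module.End.mul_eq_comp, ← map_mul, inv_mul_cancel, map_one, Module.End.one_eq_id])
  have hEg : (Eg : W.rationalTateModule ℓ →ₗ[ℚ_[ℓ]] W.rationalTateModule ℓ) = ρ g := rfl
  set L₂ : Submodule ℚ_[ℓ] (W.rationalTateModule ℓ) :=
    L₁.map (Eg : W.rationalTateModule ℓ →ₗ[ℚ_[ℓ]] W.rationalTateModule ℓ) with hL₂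
  have h₂ : finrank ℚ_[ℓ] L₂ = 1 := by rw [hL₂, LinearEquiv.finrank_map_eq, h₁]
  have hst₂ : ∀ γ : absoluteGaloisGroup L, ∀ w ∈ L₂, ρ (absGaloisRestrict K L γ) w ∈ L₂ := by
    intro γ w hw
    have hmem : g⁻¹ * absGaloisRestrict K L γ * g ∈ U := (hg _).mp ⟨γ, rfl⟩
    rw [hL₂, Submodule.mem_map] at hw ⊢
    obtain ⟨v, hv, rfl⟩ := hw
    refine ⟨ρ (g⁻¹ * absGaloisRestrict K L γ * g) v, hst _ hmem v hv, ?_⟩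
    rw [hEg]
    have e1 : g * (g⁻¹ * absGaloisRestrict K L γ * g) = absGaloisRestrict K L γ * g := by group
    have key : ρ g * ρ (g⁻¹ * absGaloisRestrict K L γ * g) = ρ (absGaloisRestrict K L γ) * ρ g := by
      rw [← map_mul, ← map_mul, e1]
    simpa only [Module.End.mul_apply] using LinearMap.congr_fun key v
  -- transport to `V_ℓ(E_L)`
  obtain ⟨E, hE⟩ := W.exists_rationalTateModule_equiv_baseChange L ℓ
  set L₃ : Submodule ℚ_[ℓ] ((W.baseChange L).rationalTateModule ℓ) :=
    L₂.map (E : W.rationalTateModule ℓ →ₗ[ℚ_[ℓ]] (W.baseChange L).rationalTateModule ℓ) with hL₃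
  have h₃ : finrank ℚ_[ℓ] L₃ = 1 := by rw [hL₃, LinearEquiv.finrank_map_eq, h₂]
  have hst₃ : ∀ γ : absoluteGaloisGroup L, ∀ y ∈ L₃,
      rationalGaloisRepTate (W.baseChange L) ℓ γ y ∈ L₃ := by
    intro γ y hy
    rw [hL₃, Submodule.mem_map] at hy ⊢
    obtain ⟨w, hw, rfl⟩ := hy
    exact ⟨ρ (absGaloisRestrict K L γ) w, hst₂ γ w hw, hE γ w⟩
  exact finrank_ne_one_of_stable_of_not_hasRationalCM_of_numberField (W.baseChange L) ℓ
    (not_hasRationalCM_baseChange_of_not_hasCM L hCM) L₃ hst₃ h₃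

/-- **An abelian open image cannot contain a split semisimple non-scalar element**
(`End_{K̄}(E) = ℤ`).  For `E = W` elliptic over a number field `K` without complex
multiplication over `K̄`, a prime `ℓ`, an open subgroup `U ≤ Γ_K` and `σ₀ ∈ U` such that
`ρ_ℓ(σ₀)` has eigenvectors `v₁, v₂ ∈ V_ℓ E` with distinct eigenvalues `μ₁ ≠ μ₂ ∈ ℚ_ℓ`: some
`ρ_ℓ(σ), ρ_ℓ(τ)`, `σ, τ ∈ U`, do not commute.  Otherwise `ρ_ℓ(U)` commutes with `ρ_ℓ(σ₀)` and
stabilizes its `μ₁`-eigenspace, a line (`finrank_eigenspace_eq_one_of_finrank_eq_two`),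
contradicting `false_of_isOpen_of_stable_line`.  (Serre 1968, IV.2.2: the image of `Γ_K` has
Lie algebra `𝔤𝔩₂`; here only its corollary "no abelian open subgroup" in the presence of a split
element.) [cite: Serre1968, Ch. IV §2.1–2.2] -/
theorem exists_mul_ne_mul_of_isOpen_of_eigenvector [NumberField K] [W.IsElliptic]
    (hCM : ¬ W.HasCM) (U : Subgroup (absoluteGaloisGroup K))
    (hU : IsOpen (U : Set (absoluteGaloisGroup K))) {σ₀ : absoluteGaloisGroup K} (hσ₀ : σ₀ ∈ U)
    {μ₁ μ₂ : ℚ_[ℓ]} (hne : μ₁ ≠ μ₂) {v₁ v₂ : W.rationalTateModule ℓ} (hv₁ : v₁ ≠ 0)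
    (hv₂ : v₂ ≠ 0) (h₁ : rationalGaloisRepTate W ℓ σ₀ v₁ = μ₁ • v₁)
    (h₂ : rationalGaloisRepTate W ℓ σ₀ v₂ = μ₂ • v₂) :
    ∃ σ ∈ U, ∃ τ ∈ U, rationalGaloisRepTate W ℓ σ * rationalGaloisRepTate W ℓ τ ≠
      rationalGaloisRepTate W ℓ τ * rationalGaloisRepTate W ℓ σ := by
  by_contra hab
  push Not at hab
  have hℓK : ((ℓ : ℕ) : K) ≠ 0 := Nat.cast_ne_zero.mpr (Fact.out : ℓ.Prime).ne_zero
  have h2 := finrank_rationalTateModule_eq_two_holds W ℓ hℓK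
  have hL₁ : finrank ℚ_[ℓ] (Module.End.eigenspace (rationalGaloisRepTate W ℓ σ₀) μ₁) = 1 :=
    finrank_eigenspace_eq_one_of_finrank_eq_two h2 hne hv₁ hv₂ h₁ h₂
  refine false_of_isOpen_of_stable_line W ℓ hCM U hU
    (Module.End.eigenspace (rationalGaloisRepTate W ℓ σ₀) μ₁) hL₁ fun σ hσ v hv ↦ ?_
  rw [Module.End.mem_eigenspace_iff] at hv ⊢
  rw [← Module.End.mul_apply, hab σ₀ hσ₀ σ hσ, Module.End.mul_apply, hv, map_smul]

end OpenSubgroup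

/-! ## Over `ℚ`: a split ordinary Frobenius -/

section Rat

/-- **An auxiliary prime.**  For a non-zero integer `d` and `p₀ ≠ 0` there is an odd prime
`ℓ ≠ p₀`, `ℓ ∤ d`, such that `d` is a square in `ℤ_ℓ`: any prime factor `ℓ` of `4p₀²d - 1`
(then `d ≡ (2p₀d)² (mod ℓ)` with `ℓ ∤ 2p₀d`, and Hensel's lemma, Mathlib `hensels_lemma`, lifts the
square root). [folklore] -/
theorem exists_prime_sq_eq_padicInt {d : ℤ} (hd : d ≠ 0) {p₀ : ℕ} (hp₀ : p₀ ≠ 0) :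
    ∃ (ℓ : ℕ) (_ : Fact ℓ.Prime), ℓ ≠ 2 ∧ ℓ ≠ p₀ ∧ ¬ (ℓ : ℤ) ∣ d ∧ ∃ z : ℤ_[ℓ], z ^ 2 = d := by
  set c : ℤ := 4 * (p₀ : ℤ) ^ 2 * d - 1 with hc
  have hc1 : c.natAbs ≠ 1 := by
    intro h1
    rcases Int.natAbs_eq_iff.mp h1 with h | h
    · -- `4 p₀² d = 2`
      have h4 : 4 * ((p₀ : ℤ) ^ 2 * d) = 2 := by push_cast at h; linarith
      omega
    · -- `4 p₀² d = 0`
      have h0 : (p₀ : ℤ) ^ 2 * d = 0 := by push_cast at h; linarith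
      rcases mul_eq_zero.mp h0 with h' | h'
      · exact hp₀ (by exact_mod_cast (pow_eq_zero_iff two_ne_zero).mp h')
      · exact hd h'
  obtain ⟨ℓ, hℓ, hℓc⟩ := Nat.exists_prime_and_dvd hc1
  have hℓc' : (ℓ : ℤ) ∣ c := Int.natCast_dvd.mpr hℓc
  haveI := Fact.mk hℓ
  -- `ℓ ∤ 4 p₀² d`, hence `ℓ ∤ 2`, `ℓ ∤ p₀`, `ℓ ∤ d`, `ℓ ∤ 2 p₀ d`
  have hndvd : ¬ (ℓ : ℤ) ∣ 4 * (p₀ : ℤ) ^ 2 * d := by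
    intro h
    have h1 : (ℓ : ℤ) ∣ 1 := by
      have := dvd_sub h hℓc'
      rwa [hc, sub_sub_cancel] at this
    exact hℓ.one_lt.ne' (by exact_mod_cast Int.eq_one_of_dvd_one (by positivity) h1)
  have hℓ2 : ℓ ≠ 2 := by
    rintro rfl
    exact hndvd ⟨2 * (p₀ : ℤ) ^ 2 * d, by ring⟩
  have hℓp₀ : ℓ ≠ p₀ := by
    rintro rfl
    exact hndvd ⟨4 * (ℓ : ℤ) * d, by ring⟩
  have hℓd : ¬ (ℓ : ℤ) ∣ d := fun h ↦ hndvd (dvd_mul_of_dvd_right h _)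
  have hℓM : ¬ (ℓ : ℤ) ∣ 2 * ((2 : ℤ) * p₀ * d) := fun h ↦ hndvd (by
    obtain ⟨k, hk⟩ := h
    exact ⟨k * p₀, by linear_combination (p₀ : ℤ) * hk⟩)
  refine ⟨ℓ, ⟨hℓ⟩, hℓ2, hℓp₀, hℓd, ?_⟩
  -- Hensel for `X² - d` at `M = 2 p₀ d`
  set M : ℤ := 2 * p₀ * d with hM
  have hMd : (ℓ : ℤ) ∣ M ^ 2 - d := by
    have e : M ^ 2 - d = d * c := by rw [hM, hc]; ring
    rw [e]
    exact dvd_mul_of_dvd_right hℓc' d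
  set F : Polynomial ℤ := X ^ 2 - C d with hF
  have hFa : F.aeval (M : ℤ_[ℓ]) = ((M ^ 2 - d : ℤ) : ℤ_[ℓ]) := by
    rw [hF]
    simp
  have hF' : F.derivative = C (2 : ℤ) * X := by
    rw [hF, derivative_sub, derivative_C, sub_zero, derivative_X_pow]
    norm_num
  have hF'a : F.derivative.aeval (M : ℤ_[ℓ]) = ((2 * M : ℤ) : ℤ_[ℓ]) := by
    rw [hF', map_mul, aeval_C, aeval_X]
    simp
  have hnorm1 : ‖F.derivative.aeval (M : ℤ_[ℓ])‖ = 1 := by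
    rw [hF'a]
    refine le_antisymm (PadicInt.norm_le_one _) ?_
    by_contra hlt
    push Not at hlt
    exact hℓM ((PadicInt.norm_int_lt_one_iff_dvd _).mp hlt)
  have hnorm : ‖F.aeval (M : ℤ_[ℓ])‖ < ‖F.derivative.aeval (M : ℤ_[ℓ])‖ ^ 2 := by
    rw [hnorm1, one_pow, hFa]
    exact (PadicInt.norm_int_lt_one_iff_dvd _).mpr hMd
  obtain ⟨z, hz, -⟩ := hensels_lemma hnorm
  refine ⟨z, ?_⟩
  have hzF : F.aeval z = z ^ 2 - (d : ℤ_[ℓ]) := by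
    rw [hF]
    simp
  rw [hzF] at hz
  exact sub_eq_zero.mp hz

/-- **(H): for a non-CM `E/ℚ`, some odd `ℓ` has `ρ_{E,ℓ}(Gal(ℚ̄/ℚ(E[ℓⁿ])))` non-abelian for
every `n`** — the hypothesis of `serre_supersingular_density_zero_of_galoisRepTate_mul_ne`
(Serre 1968, IV.2.2, `𝔤_ℓ = 𝔤𝔩₂`, in the weak form needed for IV-13 Exercise 1).  Proof: steps
1–4 of the module docstring — a good ordinary prime `p₀` (`infinite_goodOrdinaryPrimes_holds`),
a prime `ℓ` with `a_{p₀}² - 4p₀` a non-zero square in `ℤ_ℓ` (`exists_prime_sq_eq_padicInt`), an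
arithmetic Frobenius `σ₀` at `p₀` whose characteristic polynomial on `V_ℓ E` splits with distinct
roots (Silverman C.21 Remark 21.3), the Lucas-sequence lemma `pow_ne_pow_of_add_eq_of_mul_eq` for
`σ₀ᶠ ∈ ker ρ̄_{E,ℓⁿ}`, and `exists_mul_ne_mul_of_isOpen_of_eigenvector` (irreducibility of `V_ℓ`
over `ℚ(E[ℓⁿ])`, Serre 1968 IV.2.1). [cite: Serre1968, Ch. IV §2.1–2.2 and IV-13 Exercise 1] -/
theorem exists_prime_forall_exists_mul_ne (W : WeierstrassCurve ℚ) [W.IsElliptic]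
    [W.IsGloballyMinimal] (hCM : ¬ W.HasCM) :
    ∃ (ℓ : ℕ) (_ : Fact ℓ.Prime), ℓ ≠ 2 ∧ ∀ n : ℕ, ∃ σ τ : absoluteGaloisGroup ℚ,
      galoisRepTorsion W ((ℓ ^ n : ℕ) : ℤ) σ = 1 ∧ galoisRepTorsion W ((ℓ ^ n : ℕ) : ℤ) τ = 1 ∧
        W.galoisRepTate ℓ σ * W.galoisRepTate ℓ τ ≠ W.galoisRepTate ℓ τ * W.galoisRepTate ℓ σ := by
  -- a good ordinary prime `p₀`: `p₀ ∤ a`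
  obtain ⟨p₀, hp₀, hgood, hord⟩ := (infinite_goodOrdinaryPrimes_holds W).nonempty
  set a : ℤ := W.frobeniusTrace p₀ with ha
  have hp₀' : p₀.Prime := hp₀.out
  have hpp : _root_.Prime (p₀ : ℤ) := Nat.prime_iff_prime_int.mp hp₀'
  set d : ℤ := a ^ 2 - 4 * p₀ with hd
  have hd0 : d ≠ 0 := by
    intro h0
    refine hord (hpp.dvd_of_dvd_pow (n := 2) ⟨4, ?_⟩)
    linear_combination h0
  -- the prime `ℓ` and a square root `z` of `d` in `ℤ_ℓ`
  obtain ⟨ℓ, hℓ, hℓ2, hℓp₀, -, z, hz⟩ := exists_prime_sq_eq_padicInt hd0 hp₀'.ne_zero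
  refine ⟨ℓ, hℓ, hℓ2, fun n ↦ ?_⟩
  have hℓ' : ℓ.Prime := hℓ.out
  have hℓ0 : (ℓ : ℚ) ≠ 0 := by exact_mod_cast hℓ'.ne_zero
  -- an arithmetic Frobenius `σ₀` at `p₀`
  obtain ⟨v, hv⟩ : ∃ v : HeightOneSpectrum (𝓞 ℚ), (primesEquiv v : ℕ) = p₀ :=
    ⟨primesEquiv.symm ⟨p₀, hp₀'⟩, by rw [Equiv.apply_symm_apply]⟩
  have hgood' : W.HasGoodReductionAt v :=
    (hasGoodReductionAtPrime_primesEquiv_iff_holds W v p₀ hv).mp hgood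
  obtain ⟨𝔓, h𝔓⟩ := HeightOneSpectrum.primesAbove_nonempty v
  obtain ⟨σ₀, hσ₀⟩ := HeightOneSpectrum.exists_isArithFrobAt_of_mem_primesAbove_holds h𝔓
  have hne : (primesEquiv v : ℕ) ≠ ℓ := by rw [hv]; exact Ne.symm hℓp₀
  have hℓv : (ℓ : 𝓞 ℚ) ∉ v.asIdeal := natCast_not_mem_asIdeal_of_primesEquiv_ne hℓ' hne
  haveI := module_free_tateModule_holds W ℓ
  haveI := module_finite_tateModule_holds W ℓ
  -- trace and determinant of `T = ρ_T(σ₀)` on `T_ℓ E`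
  set T : Module.End ℤ_[ℓ] (W.tateModule ℓ) := W.galoisRepTate ℓ σ₀ with hT
  have htr : LinearMap.trace ℤ_[ℓ] _ T = (a : ℤ_[ℓ]) := by
    rw [hT, W.trace_galoisRepTate_frobenius_eq_frobeniusTrace ℓ hne hgood' h𝔓 hσ₀, hv]
  have hdet : LinearMap.det T = (p₀ : ℤ_[ℓ]) := by
    rw [hT, det_galoisRepTate_frobenius_of_hasGoodReductionAt_holds W ℓ v hℓv hgood' h𝔓 hσ₀,
      WeierstrassCurve.natCard_residueField_adicCompletionIntegers v, hv]
  -- `φ = ρ_V(σ₀) = 1 ⊗ T` on `V_ℓ E`; the roots `α, β` of `X² - aX + p₀`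
  set φ : Module.End ℚ_[ℓ] (W.rationalTateModule ℓ) := rationalGaloisRepTate W ℓ σ₀ with hφ
  have hφT : φ = T.baseChange ℚ_[ℓ] := rfl
  set zQ : ℚ_[ℓ] := (z : ℚ_[ℓ]) with hzQ
  have hzQ2 : zQ ^ 2 = (a : ℚ_[ℓ]) ^ 2 - 4 * (p₀ : ℚ_[ℓ]) := by
    rw [hzQ, ← PadicInt.coe_pow, hz, PadicInt.coe_intCast, hd]
    push_cast
    ring
  have hzQ0 : zQ ≠ 0 := by
    intro h0
    apply hd0
    have h : (d : ℚ_[ℓ]) = 0 := by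
      rw [hd]
      push_cast
      rw [← hzQ2, h0]
      ring
    exact_mod_cast h
  have h2Q : (2 : ℚ_[ℓ]) ≠ 0 := two_ne_zero
  set α : ℚ_[ℓ] := ((a : ℚ_[ℓ]) + zQ) / 2 with hα
  set β : ℚ_[ℓ] := ((a : ℚ_[ℓ]) - zQ) / 2 with hβ
  have hsum : α + β = (a : ℚ_[ℓ]) := by rw [hα, hβ]; field_simp; ring
  have hprod : α * β = (p₀ : ℚ_[ℓ]) := by
    rw [hα, hβ]
    field_simp
    linear_combination -hzQ2
  have hαβ : α ≠ β := by
    intro h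
    apply hzQ0
    have : α - β = zQ := by rw [hα, hβ]; field_simp; ring
    rw [← this, h, sub_self]
  -- `V_ℓ E` is a plane
  have h2V : finrank ℚ_[ℓ] (W.rationalTateModule ℓ) = 2 :=
    finrank_rationalTateModule_eq_two_holds W ℓ hℓ0
  haveI : Module.Finite ℚ_[ℓ] (W.rationalTateModule ℓ) := Module.finite_of_finrank_eq_succ h2V
  -- Cayley–Hamilton on `V_ℓ E`: `(φ - α)(φ - β) = 0 = (φ - β)(φ - α)`
  have hcharT : (T.baseChange ℚ_[ℓ]).charpoly = X ^ 2 - C (a : ℚ_[ℓ]) * X + C (p₀ : ℚ_[ℓ]) := by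
    rw [LinearMap.charpoly_baseChange, charpoly_tateModule_eq (W := W) hℓ0 T, htr, hdet]
    simp [Polynomial.map_sub, Polynomial.map_add, Polynomial.map_mul]
  have hcharφ : φ.charpoly = X ^ 2 - C (a : ℚ_[ℓ]) * X + C (p₀ : ℚ_[ℓ]) := by
    have e1 : φ.charpoly = (T.baseChange ℚ_[ℓ]).charpoly := rfl
    rw [e1, hcharT]
  have hCH : aeval φ (X ^ 2 - C (a : ℚ_[ℓ]) * X + C (p₀ : ℚ_[ℓ])) = 0 := by
    rw [← hcharφ]
    exact LinearMap.aeval_self_charpoly φ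
  have hpoly : (X - C α) * (X - C β) = X ^ 2 - C (a : ℚ_[ℓ]) * X + C (p₀ : ℚ_[ℓ]) := by
    rw [← hsum, ← hprod, C_add, C_mul]
    ring
  have hfac : (φ - algebraMap ℚ_[ℓ] _ α) * (φ - algebraMap ℚ_[ℓ] _ β) = 0 := by
    rw [← hpoly, map_mul, map_sub, map_sub, aeval_X, aeval_C, aeval_C] at hCH
    exact hCH
  have hfac' : (φ - algebraMap ℚ_[ℓ] _ β) * (φ - algebraMap ℚ_[ℓ] _ α) = 0 := by
    rw [mul_comm] at hpoly
    have h := hCH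
    rw [← hpoly, map_mul, map_sub, map_sub, aeval_X, aeval_C, aeval_C] at h
    exact h
  -- `φ` is not a scalar: its trace is `a = α + β` with `α ≠ β`
  have htrT : LinearMap.trace ℚ_[ℓ] _ (T.baseChange ℚ_[ℓ]) = (a : ℚ_[ℓ]) := by
    rw [LinearMap.trace_baseChange, htr]
    simp
  have htrφ : LinearMap.trace ℚ_[ℓ] _ φ = (a : ℚ_[ℓ]) := htrT
  have hnotscalar : ∀ c : ℚ_[ℓ], (c - α) * (c - β) = 0 → φ ≠ algebraMap ℚ_[ℓ] _ c := by
    intro c hc heq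
    have h2c : 2 * c = α + β := by
      rw [heq, Module.algebraMap_end_eq_smul_id, map_smul, LinearMap.trace_id, h2V, ← hsum] at htrφ
      rw [← htrφ]
      simp [mul_comm]
    rcases mul_eq_zero.mp hc with h | h
    · have : c = α := sub_eq_zero.mp h
      exact hαβ (by linear_combination h2c - 2 * this)
    · have : c = β := sub_eq_zero.mp h
      exact hαβ (by linear_combination -(h2c) + 2 * this)
  -- eigenvectors `v₁` (for `α`) and `v₂` (for `β`)
  obtain ⟨w₁, hw₁⟩ : ∃ w, (φ - algebraMap ℚ_[ℓ] _ β) w ≠ 0 := by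
    by_contra hall
    push Not at hall
    refine hnotscalar β (by ring) (LinearMap.ext fun w ↦ ?_)
    have h := hall w
    rwa [LinearMap.sub_apply, sub_eq_zero] at h
  obtain ⟨w₂, hw₂⟩ : ∃ w, (φ - algebraMap ℚ_[ℓ] _ α) w ≠ 0 := by
    by_contra hall
    push Not at hall
    refine hnotscalar α (by ring) (LinearMap.ext fun w ↦ ?_)
    have h := hall w
    rwa [LinearMap.sub_apply, sub_eq_zero] at h
  set v₁ := (φ - algebraMap ℚ_[ℓ] _ β) w₁ with hv₁
  set v₂ := (φ - algebraMap ℚ_[ℓ] _ α) w₂ with hv₂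
  have hφv₁ : φ v₁ = α • v₁ := by
    have h := congrArg (fun f : Module.End ℚ_[ℓ] (W.rationalTateModule ℓ) ↦ f w₁) hfac
    simp only [Module.End.mul_apply, LinearMap.zero_apply, LinearMap.sub_apply,
      Module.algebraMap_end_apply] at h
    rw [hv₁, LinearMap.sub_apply, Module.algebraMap_end_apply]
    exact sub_eq_zero.mp h
  have hφv₂ : φ v₂ = β • v₂ := by
    have h := congrArg (fun f : Module.End ℚ_[ℓ] (W.rationalTateModule ℓ) ↦ f w₂) hfac'
    simp only [Module.End.mul_apply, LinearMap.zero_apply, LinearMap.sub_apply,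
      Module.algebraMap_end_apply] at h
    rw [hv₂, LinearMap.sub_apply, Module.algebraMap_end_apply]
    exact sub_eq_zero.mp h
  -- level `n`: `U = ker ρ̄_{E,ℓⁿ}`, open of finite index `f`, and `σ₀ᶠ ∈ U`
  have hN0 : ((ℓ ^ n : ℕ) : ℤ) ≠ 0 := by exact_mod_cast (pow_pos hℓ'.pos n).ne'
  set U : Subgroup (absoluteGaloisGroup ℚ) := (galoisRepTorsion W ((ℓ ^ n : ℕ) : ℤ)).ker with hU
  have hUopen : IsOpen (U : Set (absoluteGaloisGroup ℚ)) := by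
    rw [hU]
    exact isOpen_ker_galoisRepTorsion_holds W hN0
  haveI : Finite (absoluteGaloisGroup ℚ ⧸ U) := by
    rw [hU]
    exact finite_quotient_ker_galoisRepTorsion W hN0
  haveI hUn : U.Normal := by
    rw [hU]
    infer_instance
  set f : ℕ := Nat.card (absoluteGaloisGroup ℚ ⧸ U) with hf
  have hf0 : f ≠ 0 := Nat.card_pos.ne'
  have hσf : σ₀ ^ f ∈ U := by
    rw [← QuotientGroup.eq_one_iff, QuotientGroup.mk_pow, hf]
    exact pow_card_eq_one'
  -- `ρ_V(σ₀ᶠ) = φᶠ` has the eigenvectors `v₁, v₂` with the distinct eigenvalues `αᶠ ≠ βᶠ`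
  have hpow : rationalGaloisRepTate W ℓ (σ₀ ^ f) = φ ^ f := by rw [map_pow]
  have h₁ : rationalGaloisRepTate W ℓ (σ₀ ^ f) v₁ = α ^ f • v₁ := by
    rw [hpow]; exact pow_apply_of_apply_eq_smul hφv₁ f
  have h₂ : rationalGaloisRepTate W ℓ (σ₀ ^ f) v₂ = β ^ f • v₂ := by
    rw [hpow]; exact pow_apply_of_apply_eq_smul hφv₂ f
  have hnef : α ^ f ≠ β ^ f := pow_ne_pow_of_add_eq_of_mul_eq hp₀' hord hsum hprod hf0
  obtain ⟨σ, hσ, τ, hτ, hστ⟩ :=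
    exists_mul_ne_mul_of_isOpen_of_eigenvector W ℓ hCM U hUopen hσf hnef hw₁ hw₂ h₁ h₂
  refine ⟨σ, τ, MonoidHom.mem_ker.mp hσ, MonoidHom.mem_ker.mp hτ, fun hc ↦ hστ ?_⟩
  change (W.galoisRepTate ℓ σ).baseChange ℚ_[ℓ] * (W.galoisRepTate ℓ τ).baseChange ℚ_[ℓ] =
    (W.galoisRepTate ℓ τ).baseChange ℚ_[ℓ] * (W.galoisRepTate ℓ σ).baseChange ℚ_[ℓ]
  rw [← LinearMap.baseChange_mul, ← LinearMap.baseChange_mul, hc]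

/-- **Serre 1981, p. 123 (a) / §8 Thm. 20, Cor. 2 (qualitative form): the discharge of the named
fact `serre_supersingular_density_zero`.**  For every elliptic curve `E/ℚ` in global minimal form
without complex multiplication the good supersingular primes (`p ∤ Δ`, `p ∣ a_p`) have natural
density `0`: `serre_supersingular_density_zero_of_galoisRepTate_mul_ne` (prime ideal theorem,
Chebotarev-type upper bound, contraction along the `ℓ`-adic tower — parts 1–13 of this series)
applied to (H) `exists_prime_forall_exists_mul_ne` (irreducibility of `V_ℓ E` over the division
fields, Shafarevich–Serre, and a split ordinary Frobenius).  Serre proves the quantitative form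
`P_{E,0}(x) = O(x/(log x)^{3/2-δ})` by the effective Chebotarev theorem; the density-`0`
statement vendored in the tree is its corollary, attributed by Serre to *Abelian ℓ-adic
representations* (1968), IV-13, Exercise 1.
[cite: Serre1981, p. 123 (a) and §8 Thm. 20, Cor. 2 (245)] [cite: Serre1968, IV-13 Exercise 1] -/
theorem serre_supersingular_density_zero_holds : serre_supersingular_density_zero :=
  serre_supersingular_density_zero_of_galoisRepTate_mul_ne fun W _ _ hCM ↦
    exists_prime_forall_exists_mul_ne W hCM

end Rat

end WeierstrassCurve
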